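import Literature.Computability.Cryptography.LWEFirstIsErrorlessReduction
import Literature.Probability.Distributions.IndepProductLaw
import HarnessLib

/-!
# Extended LWE (BLPRS 2013, Def. 4.4) and the multi-secret hybrid reduction (Lemma 4.8), as exact laws

Topic `Computability/Cryptography` (LWE), grouping namespace `LWE` (the model of
`Literature/Computability/Cryptography/LWE.lean`). Proved material (no named fact is introduced)
towards the named fact `Literature.Computability.Cryptography.blprs_gapSVP_sqrt_dim_to_lwe_classical`
(**pqc.S21**; Brakerski–Langlois–Peikert–Regev–Stehlé, *Classical hardness of learning with
errors*, STOC 2013, Thm. 1.1), namely the intermediate problem of §4.2 and the third of the four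
transformation reductions in the proof of the binary-secret Theorem 4.1:

> **Definition 4.4.** For `n, m, q, t ≥ 1`, `𝒵 ⊆ ℤᵐ` and a distribution `χ` over `q⁻¹ℤᵐ`, the
> `extLWE^t_{n,m,q,χ,𝒵}` problem is as follows. The algorithm gets to choose `z ∈ 𝒵` and then receives
> a tuple `(A, (bᵢ)_{i∈[t]}, (⟨eᵢ, z⟩)_{i∈[t]}) ∈ 𝕋_q^{n×m} × (𝕋_qᵐ)ᵗ × (q⁻¹ℤ)ᵗ`. Its goal is to
> distinguish between the following two cases. In the first, `A` is uniform, the `eᵢ` are chosen from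
> `χ`, and `bᵢ = Aᵀsᵢ + eᵢ mod 1` where the `sᵢ ∈ {0,…,q-1}ⁿ` are uniform. The second case is identical,
> except that the `bᵢ` are chosen uniformly in `𝕋_qᵐ` independently of everything else.
>
> **Lemma 4.8.** Let `χ` be efficiently sampleable and `t ≥ 1`. Then there is an efficient
> (transformation) reduction from `extLWE_{n,m,q,χ,𝒵}` to `extLWE^t_{n,m,q,χ,𝒵}` that reduces the
> advantage by a factor of `t`. (Proof: a standard hybrid argument, `t · Adv[ℬ] = Adv[𝒜]`.)

**Model.** Multiplying the printed data by `q` identifies `𝕋_q = q⁻¹ℤ/ℤ` with `ℤ_q`, `q⁻¹ℤᵐ` with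
`ℤᵐ` and `q⁻¹ℤ` with `ℤ` (a group isomorphism), so — over any finite commutative ring `R` in place of
`ℤ_q` — a transcript is `(A, (bᵢ, hᵢ)_{i<t})` with `A ∈ R^{n×m}`, `bᵢ ∈ Rᵐ`, INTEGER noise `eᵢ ← χ`
(`χ : PMF (ℤᵐ)`, not reduced modulo `q`, as the hint requires) entering `bᵢ = Aᵀsᵢ + eᵢ` through
`ℤ → R`, and exact integer hints `hᵢ = ⟨eᵢ, z⟩`. The choice of `z` precedes everything, so the two
transcript laws and the advantage are indexed by `z` (a randomised choice is an average of these; the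
reductions of Lemma 4.8 forward the same `z`).

## Results

* over the tree's `indepLaw t P` (`Probability/Distributions/IndepProductLaw.lean`: the law of an
  independent, not identically distributed `t`-tuple on an arbitrary type, product formula
  `indepLaw_apply`; the iid case is `iidPMF`, `indepLaw_const` of `IndepLawBridge.lean`) two kernel
  lemmas: `indepLaw_one_bind` and `bind_indepLaw_update` (**resampling one coordinate**:
  `Q.bind (x ↦ ⨂ update P j δₓ) = ⨂ update P j Q`);
* Def. 4.4: `extLWESecretSample`, `extLWEUniformSample` (one position in either world),
  `extLWEReal χ t z`, `extLWEIdeal χ t z`, `extLWEAdvantage χ t z D`; the hybrids `extLWEHybrid χ t z j`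
  (positions `< j` real, the rest uniform) with `extLWEReal_eq_hybrid` (`j = t`), `extLWEIdeal_eq_hybrid`
  (`j = 0`);
* Lemma 4.8: `extLWEFill` (ℬ's simulation of the other `t - 1` positions around its challenge at a
  position `i*`), `extLWEMultiReduction` (ℬ from 𝒜: uniform `i*`, fill, run 𝒜);
  `extLWEReal_one_bind_fill` / `extLWEIdeal_one_bind_fill` (**ℬ fed a real resp. uniform sample
  produces exactly `H_{i*+1}` resp. `H_{i*}`**), `toReal_acceptProb_extLWEMultiReduction` (average over
  `i*`), and **`extLWEAdvantage_multiReduction`**: `t · Adv_{extLWE}(ℬ) = Adv_{extLWE^t}(𝒜)` (telescoping).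

## References

* Z. Brakerski, A. Langlois, C. Peikert, O. Regev, D. Stehlé, *Classical hardness of learning with
  errors*, STOC 2013; arXiv:1306.0281, §4.2, Def. 4.4 and Lemma 4.8 with its proof.
-/

noncomputable section

open scoped ENNReal
open Matrix

namespace Literature.Computability.Cryptography

namespace LWE

open Literature.Probability.Distributions

/-! ### Two kernel lemmas for the tree's independent product `indepLaw` -/

section Indep

variable {α β : Type}

/-- Two families with the same laws give the same independent tuple. [folklore] -/
theorem indepLaw_congr_of_forall {t : ℕ} {P P' : Fin t → PMF α} (h : ∀ i, P i = P' i) :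
    indepLaw t P = indepLaw t P' := by
  rw [show P = P' from funext h]

/-- A one-coordinate independent tuple, consumed through its only coordinate, is that law.
[folklore] -/
theorem indepLaw_one_bind (P : Fin 1 → PMF α) (g : α → PMF β) :
    ((indepLaw 1 P).bind fun w => g (w 0)) = (P 0).bind g := by
  rw [indepLaw_succ, PMF.bind_bind]
  refine congrArg _ (funext fun x => ?_)
  rw [indepLaw_zero, PMF.pure_map, PMF.pure_bind, Fin.cons_zero]

/-- **Resampling one coordinate**: drawing `x ← Q` and then the independent tuple whose `j`-th law is
the Dirac mass at `x` is the independent tuple whose `j`-th law is `Q`. [folklore] -/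
theorem bind_indepLaw_update {t : ℕ} (P : Fin t → PMF α) (j : Fin t) (Q : PMF α) :
    (Q.bind fun x => indepLaw t (Function.update P j (PMF.pure x))) = indepLaw t (Function.update P j Q) := by
  classical
  ext f
  rw [PMF.bind_apply, indepLaw_apply]
  simp_rw [indepLaw_apply]
  have hsplit : ∀ R : PMF α, ∏ i, Function.update P j R i (f i) = R (f j) * ∏ i ∈ Finset.univ.erase j, P i (f i) := by
    intro R
    rw [← Finset.mul_prod_erase Finset.univ _ (Finset.mem_univ j), Function.update_self]
    congr 1
    exact Finset.prod_congr rfl fun i hi => by rw [Function.update_of_ne (Finset.ne_of_mem_erase hi)]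
  simp_rw [hsplit]
  have hQ : ∑' x, Q x * (PMF.pure x) (f j) = Q (f j) := by
    rw [tsum_eq_single (f j)]
    · rw [PMF.pure_apply, if_pos rfl, mul_one]
    · intro x hx
      rw [PMF.pure_apply, if_neg (Ne.symm hx), mul_zero]
  calc ∑' x, Q x * ((PMF.pure x) (f j) * ∏ i ∈ Finset.univ.erase j, P i (f i))
      = ∑' x, (Q x * (PMF.pure x) (f j)) * ∏ i ∈ Finset.univ.erase j, P i (f i) := by simp_rw [mul_assoc]
    _ = (∑' x, Q x * (PMF.pure x) (f j)) * ∏ i ∈ Finset.univ.erase j, P i (f i) := ENNReal.tsum_mul_right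
    _ = Q (f j) * ∏ i ∈ Finset.univ.erase j, P i (f i) := by rw [hQ]

end Indep

/-! ### Definition 4.4: extended LWE -/

section Def44

variable {R : Type} [CommRing R] [Fintype R] {n m : ℕ}

/-- One position of an `extLWE` transcript in the FIRST (LWE) case, given the matrix `A` and the hint
vector `z`: `s ← U(Rⁿ)`, `e ← χ` (integer noise), output `(Aᵀ s + e, ⟨e, z⟩)`.
[cite: BrakerskiEtAl2013, Def. 4.4] -/
def extLWESecretSample (χ : PMF (Fin m → ℤ)) (A : Matrix (Fin n) (Fin m) R) (z : Fin m → ℤ) :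
    PMF ((Fin m → R) × ℤ) :=
  (PMF.uniformOfFintype (Fin n → R)).bind fun s => χ.map fun e => (Aᵀ *ᵥ s + fun j => (e j : R), e ⬝ᵥ z)

/-- One position of an `extLWE` transcript in the SECOND (uniform) case: `b ← U(Rᵐ)` "independently of
everything else", the hint still `⟨e, z⟩` with `e ← χ`. [cite: BrakerskiEtAl2013, Def. 4.4] -/
def extLWEUniformSample (χ : PMF (Fin m → ℤ)) (z : Fin m → ℤ) : PMF ((Fin m → R) × ℤ) :=
  (PMF.uniformOfFintype (Fin m → R)).bind fun b => χ.map fun e => (b, e ⬝ᵥ z)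

/-- **`extLWE^t`, first case** (Def. 4.4) for the choice `z`: `A ← U(R^{n×m})`, then `t` independent
positions `(Aᵀ sᵢ + eᵢ, ⟨eᵢ, z⟩)`. [cite: BrakerskiEtAl2013, Def. 4.4] -/
def extLWEReal (χ : PMF (Fin m → ℤ)) (t : ℕ) (z : Fin m → ℤ) :
    PMF (Matrix (Fin n) (Fin m) R × (Fin t → (Fin m → R) × ℤ)) :=
  (PMF.uniformOfFintype (Matrix (Fin n) (Fin m) R)).bind fun A =>
    (indepLaw t fun _ => extLWESecretSample χ A z).map fun w => (A, w)

variable (n) in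
/-- **`extLWE^t`, second case** (Def. 4.4) for the choice `z`: `A ← U(R^{n×m})`, then `t` independent
positions `(bᵢ, ⟨eᵢ, z⟩)` with `bᵢ` uniform. [cite: BrakerskiEtAl2013, Def. 4.4] -/
def extLWEIdeal (χ : PMF (Fin m → ℤ)) (t : ℕ) (z : Fin m → ℤ) :
    PMF (Matrix (Fin n) (Fin m) R × (Fin t → (Fin m → R) × ℤ)) :=
  (PMF.uniformOfFintype (Matrix (Fin n) (Fin m) R)).bind fun A =>
    (indepLaw t fun _ => extLWEUniformSample χ z).map fun w => (A, w)

/-- The advantage on `extLWE^t` of a test `D` for the choice `z` (§2: `Adv[𝒜] = |Pr[𝒜(P₀)] - Pr[𝒜(P₁)]|`).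
[cite: BrakerskiEtAl2013, Def. 4.4] -/
def extLWEAdvantage (χ : PMF (Fin m → ℤ)) (t : ℕ) (z : Fin m → ℤ)
    (D : Matrix (Fin n) (Fin m) R × (Fin t → (Fin m → R) × ℤ) → PMF Bool) : ℝ :=
  |(acceptProb D (extLWEReal χ t z)).toReal - (acceptProb D (extLWEIdeal n χ t z)).toReal|

/-- **The hybrids `H_j`** of the proof of Lemma 4.8: `A` uniform, positions `i < j` as in the first
case, positions `i ≥ j` as in the second (printed `H_i = (A, {b₁,…,bᵢ, u_{i+1},…,u_t}, z, {⟨z, eᵢ⟩})`).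
[cite: BrakerskiEtAl2013, Lemma 4.8 (proof)] -/
def extLWEHybrid (χ : PMF (Fin m → ℤ)) (t : ℕ) (z : Fin m → ℤ) (j : ℕ) :
    PMF (Matrix (Fin n) (Fin m) R × (Fin t → (Fin m → R) × ℤ)) :=
  (PMF.uniformOfFintype (Matrix (Fin n) (Fin m) R)).bind fun A =>
    (indepLaw t fun i => if (i : ℕ) < j then extLWESecretSample χ A z else extLWEUniformSample χ z).map
      fun w => (A, w)

/-- `H_t` is the first case. [cite: BrakerskiEtAl2013, Lemma 4.8 (proof)] -/
theorem extLWEReal_eq_hybrid (χ : PMF (Fin m → ℤ)) (t : ℕ) (z : Fin m → ℤ) :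
    extLWEReal χ t z = extLWEHybrid (n := n) (R := R) χ t z t := by
  unfold extLWEReal extLWEHybrid
  refine congrArg _ (funext fun A => ?_)
  rw [indepLaw_congr_of_forall fun i => (if_pos i.2).symm]

/-- `H_0` is the second case. [cite: BrakerskiEtAl2013, Lemma 4.8 (proof)] -/
theorem extLWEIdeal_eq_hybrid (χ : PMF (Fin m → ℤ)) (t : ℕ) (z : Fin m → ℤ) :
    extLWEIdeal n χ t z = extLWEHybrid (n := n) (R := R) χ t z 0 := by
  unfold extLWEIdeal extLWEHybrid
  refine congrArg _ (funext fun A => ?_)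
  rw [indepLaw_congr_of_forall fun i => (if_neg (Nat.not_lt_zero _)).symm]

end Def44

/-! ### Lemma 4.8: the hybrid reduction from `extLWE` to `extLWE^t` -/

section Lemma48

variable {R : Type} [CommRing R] [Fintype R] {n m : ℕ}

/-- ℬ's simulation around its challenge: with the challenge sample `x` placed at position `i*`,
positions `i < i*` are filled as in the first case (fresh `sᵢ, eᵢ`) and positions `i > i*` as in the
second (fresh uniform `bᵢ`, fresh `eᵢ` for the hints) — "`χ` efficiently sampleable".
[cite: BrakerskiEtAl2013, Lemma 4.8 (proof)] -/
def extLWEFill (χ : PMF (Fin m → ℤ)) (t : ℕ) (z : Fin m → ℤ) (A : Matrix (Fin n) (Fin m) R)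
    (iStar : Fin t) (x : (Fin m → R) × ℤ) : PMF (Fin t → (Fin m → R) × ℤ) :=
  indepLaw t (Function.update
    (fun i => if (i : ℕ) < iStar then extLWESecretSample χ A z else extLWEUniformSample χ z) iStar (PMF.pure x))

/-- **The reduction ℬ of Lemma 4.8** from a test `D` for `extLWE^t`: on a one-position transcript
`(A, (d, y))`, sample `i* ← [t]`, fill the other positions, run `D`. [cite: BrakerskiEtAl2013, Lemma 4.8 (proof)] -/
def extLWEMultiReduction (χ : PMF (Fin m → ℤ)) (t : ℕ) [NeZero t] (z : Fin m → ℤ)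
    (D : Matrix (Fin n) (Fin m) R × (Fin t → (Fin m → R) × ℤ) → PMF Bool) :
    Matrix (Fin n) (Fin m) R × (Fin 1 → (Fin m → R) × ℤ) → PMF Bool :=
  fun T => (PMF.uniformOfFintype (Fin t)).bind fun iStar =>
    (extLWEFill χ t z T.1 iStar (T.2 0)).bind fun w => D (T.1, w)

/-- Filling around a position resampled from the FIRST case gives the family of `H_{i*+1}`.
[cite: BrakerskiEtAl2013, Lemma 4.8 (proof: "then ℬ feeds 𝒜 with exactly the distribution H_{i*}")] -/
theorem extLWESecretSample_bind_fill (χ : PMF (Fin m → ℤ)) (t : ℕ) (z : Fin m → ℤ)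
    (A : Matrix (Fin n) (Fin m) R) (iStar : Fin t) :
    ((extLWESecretSample χ A z).bind fun x => extLWEFill χ t z A iStar x) =
      indepLaw t fun i => if (i : ℕ) < iStar + 1 then extLWESecretSample χ A z else extLWEUniformSample χ z := by
  unfold extLWEFill
  rw [bind_indepLaw_update]
  refine indepLaw_congr_of_forall fun i => ?_
  rcases lt_trichotomy (i : ℕ) iStar with h | h | h
  · simp only [Function.update_of_ne (ne_of_lt (show i < iStar from h)), if_pos h, if_pos (Nat.lt_succ_of_lt h)]
  · rw [show i = iStar from Fin.ext h, Function.update_self, if_pos (Nat.lt_succ_self _)]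
  · simp only [Function.update_of_ne (ne_of_gt (show iStar < i from h)), if_neg (Nat.not_lt.2 h.le),
      if_neg (Nat.not_lt.2 (Nat.succ_le_of_lt h))]

/-- Filling around a position resampled from the SECOND case gives the family of `H_{i*}`.
[cite: BrakerskiEtAl2013, Lemma 4.8 (proof: "if the input to ℬ is P₁ … then ℬ feeds 𝒜 with H_{i*-1}")] -/
theorem extLWEUniformSample_bind_fill (χ : PMF (Fin m → ℤ)) (t : ℕ) (z : Fin m → ℤ)
    (A : Matrix (Fin n) (Fin m) R) (iStar : Fin t) :
    ((extLWEUniformSample χ z).bind fun x => extLWEFill χ t z A iStar x) =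
      indepLaw t fun i => if (i : ℕ) < iStar then extLWESecretSample χ A z else extLWEUniformSample χ z := by
  unfold extLWEFill
  rw [bind_indepLaw_update]
  refine indepLaw_congr_of_forall fun i => ?_
  by_cases h : i = iStar
  · rw [h, Function.update_self, if_neg (lt_irrefl _)]
  · simp only [Function.update_of_ne h]

/-- **ℬ fed with one transcript of the first case produces exactly `H_{i*+1}`.**
[cite: BrakerskiEtAl2013, Lemma 4.8 (proof)] -/
theorem extLWEReal_one_bind_fill (χ : PMF (Fin m → ℤ)) (t : ℕ) (z : Fin m → ℤ) (iStar : Fin t) :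
    ((extLWEReal (n := n) (R := R) χ 1 z).bind fun T =>
        (extLWEFill χ t z T.1 iStar (T.2 0)).map fun w => (T.1, w)) = extLWEHybrid χ t z (iStar + 1) := by
  unfold extLWEReal extLWEHybrid
  rw [PMF.bind_bind]
  refine congrArg _ (funext fun A => ?_)
  rw [PMF.bind_map]
  change ((indepLaw 1 fun _ => extLWESecretSample χ A z).bind fun w =>
      (extLWEFill χ t z A iStar (w 0)).map fun w' => (A, w')) = _
  rw [indepLaw_one_bind (fun _ => extLWESecretSample χ A z) fun x =>
      (extLWEFill χ t z A iStar x).map fun w' => (A, w'),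
    ← PMF.map_bind, extLWESecretSample_bind_fill]

/-- **ℬ fed with one transcript of the second case produces exactly `H_{i*}`.**
[cite: BrakerskiEtAl2013, Lemma 4.8 (proof)] -/
theorem extLWEIdeal_one_bind_fill (χ : PMF (Fin m → ℤ)) (t : ℕ) (z : Fin m → ℤ) (iStar : Fin t) :
    ((extLWEIdeal (R := R) n χ 1 z).bind fun T =>
        (extLWEFill χ t z T.1 iStar (T.2 0)).map fun w => (T.1, w)) = extLWEHybrid χ t z iStar := by
  unfold extLWEIdeal extLWEHybrid
  rw [PMF.bind_bind]
  refine congrArg _ (funext fun A => ?_)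
  rw [PMF.bind_map]
  change ((indepLaw 1 fun _ => extLWEUniformSample χ z).bind fun w =>
      (extLWEFill χ t z A iStar (w 0)).map fun w' => (A, w')) = _
  rw [indepLaw_one_bind (fun _ => extLWEUniformSample (R := R) χ z) fun x =>
      (extLWEFill χ t z A iStar x).map fun w' => (A, w'),
    ← PMF.map_bind, extLWEUniformSample_bind_fill]

/-- The acceptance probability of ℬ on any one-position law `P` is that of `D` on the mixture over a
uniform `i*` of "fill around `P`'s sample". [cite: BrakerskiEtAl2013, Lemma 4.8 (proof)] -/
theorem acceptProb_extLWEMultiReduction (χ : PMF (Fin m → ℤ)) (t : ℕ) [NeZero t] (z : Fin m → ℤ)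
    (D : Matrix (Fin n) (Fin m) R × (Fin t → (Fin m → R) × ℤ) → PMF Bool)
    (P : PMF (Matrix (Fin n) (Fin m) R × (Fin 1 → (Fin m → R) × ℤ))) :
    acceptProb (extLWEMultiReduction χ t z D) P =
      acceptProb D ((PMF.uniformOfFintype (Fin t)).bind fun iStar =>
        P.bind fun T => (extLWEFill χ t z T.1 iStar (T.2 0)).map fun w => (T.1, w)) := by
  unfold acceptProb extLWEMultiReduction
  rw [PMF.bind_comm P (PMF.uniformOfFintype (Fin t))]
  simp only [PMF.bind_bind, PMF.bind_map]
  rfl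

/-- **BLPRS 2013, Lemma 4.8** (exact form of the printed computation `t · Adv[ℬ] = Adv[𝒜]`): for every
test `D` on `extLWE^t` and every choice `z`, the one-position test `ℬ = extLWEMultiReduction D`
satisfies `t · Adv_{extLWE}(ℬ) = Adv_{extLWE^t}(D)` — ℬ on the first case is the uniform mixture of the
`H_{i*+1}`, on the second case that of the `H_{i*}`, and the sum telescopes to `H_t - H_0`.
[cite: BrakerskiEtAl2013, Lemma 4.8] -/
theorem extLWEAdvantage_multiReduction (χ : PMF (Fin m → ℤ)) (t : ℕ) [NeZero t] (z : Fin m → ℤ)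
    (D : Matrix (Fin n) (Fin m) R × (Fin t → (Fin m → R) × ℤ) → PMF Bool) :
    (t : ℝ) * extLWEAdvantage χ 1 z (extLWEMultiReduction χ t z D) = extLWEAdvantage χ t z D := by
  set h : ℕ → ℝ := fun j => (acceptProb D (extLWEHybrid (n := n) (R := R) χ t z j)).toReal with hh
  have ht : (0 : ℝ) < t := by exact_mod_cast Nat.pos_of_ne_zero (NeZero.ne t)
  have hreal : (acceptProb (extLWEMultiReduction χ t z D) (extLWEReal χ 1 z)).toReal =
      ∑ iStar : Fin t, (t : ℝ)⁻¹ * h (iStar + 1) := by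
    rw [acceptProb_extLWEMultiReduction, toReal_acceptProb_uniform_bind]
    refine Finset.sum_congr rfl fun iStar _ => ?_
    rw [Fintype.card_fin, extLWEReal_one_bind_fill]
  have hideal : (acceptProb (extLWEMultiReduction χ t z D) (extLWEIdeal n χ 1 z)).toReal =
      ∑ iStar : Fin t, (t : ℝ)⁻¹ * h iStar := by
    rw [acceptProb_extLWEMultiReduction, toReal_acceptProb_uniform_bind]
    refine Finset.sum_congr rfl fun iStar _ => ?_
    rw [Fintype.card_fin, extLWEIdeal_one_bind_fill]
  unfold extLWEAdvantage
  rw [hreal, hideal, ← Finset.sum_sub_distrib]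
  simp_rw [← mul_sub]
  rw [← Finset.mul_sum, abs_mul, abs_of_pos (inv_pos.2 ht), ← mul_assoc, mul_inv_cancel₀ ht.ne', one_mul,
    Fin.sum_univ_eq_sum_range (fun i => h (i + 1) - h i) t, Finset.sum_range_sub, extLWEReal_eq_hybrid,
    extLWEIdeal_eq_hybrid]

end Lemma48

end LWE

end Literature.Computability.Cryptography

end
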